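import Summits.Ventures.PercRepro.Defs

/-!
# PercRepro — classical toolbox, statement layer (typer-2, gen 2, sparse root)

Built on typer-1's `Defs.lean` (`Config E = E → Bool`, `IsProb`, `weight`, `prob`, `expect`).
The configuration space carries the product (pointwise) order with `false < true`, so increasing
events are exactly the `IsUpperSet`s and decreasing events the `IsLowerSet`s.

Contents
* `harris_expect`, `harris` — Harris / FKG positive association (nonnegative increasing functions;
  increasing events), PROVED from Mathlib's `fkg` (four functions theorem, file
  `Mathlib/Combinatorics/SetFamily/FourFunctions.lean`) because the product weight is log-modular
  (`weight_inf_mul_weight_sup`) and sums to `1` (`sum_weight`).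
* `harris_upper_lower` (an increasing and a decreasing event are negatively correlated) and
  `harris_lower` (two decreasing events are positively correlated), by complementation.
* `OccursOn`, `disjOccur` (`A ◻ B`, disjoint occurrence in cylinder form, the operation of
  Reimer's theorem), `restrictTo`, `disjOccurRestrict` (open-witness form, the form in which the BK
  inequality for increasing events is proved) and their equivalence for increasing events
  (`disjOccur_eq_disjOccurRestrict`).
* `condProb` (`P(A | B)`) and the translation of conditional correlation inequalities into the
  product form used by the conjecture rows (`condProb_inter_le_mul_iff`,
  `mul_condProb_le_condProb_inter_iff`).
* `BKInequality E`, `ReimerInequality E` — the BK inequality and Reimer's theorem STATED as named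
  Props (Mathlib has neither); `BKInequality_iff_restrict` lets a proof in open-witness form
  discharge `BKInequality E`.
-/

namespace PercRepro

open Finset

variable {E : Type*} [Fintype E] [DecidableEq E]

/-! ### Harris / FKG -/

/-- **Harris / FKG inequality** (expectation form): nonnegative increasing functions are
positively correlated under the product Bernoulli measure, `E[f] E[g] ≤ E[f g]`. Proved from
Mathlib's `fkg` (four functions theorem) via log-modularity of the product weight. -/
theorem harris_expect {p : E → ℝ} (hp : IsProb p) {f g : Config E → ℝ}
    (hf0 : 0 ≤ f) (hg0 : 0 ≤ g) (hf : Monotone f) (hg : Monotone g) :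
    expect p f * expect p g ≤ expect p (f * g) := by
  have h := fkg f g (weight p) (weight_nonneg hp) hf0 hg0 hf hg
    (fun a b => (weight_inf_mul_weight_sup p a b).le)
  simpa [expect, sum_weight] using h

omit [Fintype E] [DecidableEq E] in
/-- The indicator of an increasing event is a monotone function. -/
lemma monotone_indicator_one {A : Set (Config E)} (hA : IsUpperSet A) :
    Monotone (A.indicator (1 : Config E → ℝ)) := by
  intro a b hab
  by_cases ha : a ∈ A
  · have hb : b ∈ A := hA hab ha
    simp [Set.indicator, ha, hb]
  · simp [Set.indicator, ha]
    split_ifs <;> norm_num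

/-- **Harris / FKG inequality** (event form): increasing events are positively correlated,
`P(A) P(B) ≤ P(A ∩ B)`. -/
theorem harris {p : E → ℝ} (hp : IsProb p) {A B : Set (Config E)}
    (hA : IsUpperSet A) (hB : IsUpperSet B) :
    prob p A * prob p B ≤ prob p (A ∩ B) := by
  rw [prob_eq_expect_indicator, prob_eq_expect_indicator, prob_eq_expect_indicator]
  have h := harris_expect hp (f := A.indicator 1) (g := B.indicator 1)
    (fun _ => Set.indicator_nonneg (fun _ _ => zero_le_one) _)
    (fun _ => Set.indicator_nonneg (fun _ _ => zero_le_one) _)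
    (monotone_indicator_one hA) (monotone_indicator_one hB)
  convert h using 2
  funext ω
  show (A ∩ B).indicator (1 : Config E → ℝ) ω =
    A.indicator (1 : Config E → ℝ) ω * B.indicator (1 : Config E → ℝ) ω
  by_cases ha : ω ∈ A <;> by_cases hb : ω ∈ B <;> simp [Set.indicator, ha, hb]

/-- **Harris inequality, mixed form**: an increasing and a decreasing event are negatively
correlated, `P(A ∩ B) ≤ P(A) P(B)`. -/
theorem harris_upper_lower {p : E → ℝ} (hp : IsProb p) {A B : Set (Config E)}
    (hA : IsUpperSet A) (hB : IsLowerSet B) :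
    prob p (A ∩ B) ≤ prob p A * prob p B := by
  have h1 := harris hp hA hB.compl
  have h2 := prob_inter_add_prob_inter_compl p A B
  have h3 := prob_compl p B
  nlinarith [prob_nonneg hp A]

/-- **Harris inequality for decreasing events**: two decreasing events are positively
correlated, `P(A) P(B) ≤ P(A ∩ B)`. -/
theorem harris_lower {p : E → ℝ} (hp : IsProb p) {A B : Set (Config E)}
    (hA : IsLowerSet A) (hB : IsLowerSet B) :
    prob p A * prob p B ≤ prob p (A ∩ B) := by
  have h1 := harris_upper_lower hp hA.compl hB
  have h2 := prob_inter_add_prob_inter_compl p B A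
  have h3 := prob_compl p A
  rw [Set.inter_comm B A, Set.inter_comm B Aᶜ] at h2
  nlinarith [prob_nonneg hp B]

/-! ### Conditional probability -/

/-- Conditional probability `P(A | B) = P(A ∩ B) / P(B)` (`= 0` when `P(B) = 0`, since `x / 0 = 0`
in Lean). The conjecture rows are stated in product form (no division); these lemmas translate. -/
noncomputable def condProb (p : E → ℝ) (A B : Set (Config E)) : ℝ := prob p (A ∩ B) / prob p B

/-- Conditional negative correlation given `B` in product form: for `P(B) > 0`,
`P(A ∩ A' | B) ≤ P(A | B) P(A' | B)` iff `P(A ∩ A' ∩ B) P(B) ≤ P(A ∩ B) P(A' ∩ B)`. -/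
lemma condProb_inter_le_mul_iff {p : E → ℝ} {A A' B : Set (Config E)} (hB : 0 < prob p B) :
    condProb p (A ∩ A') B ≤ condProb p A B * condProb p A' B ↔
      prob p (A ∩ A' ∩ B) * prob p B ≤ prob p (A ∩ B) * prob p (A' ∩ B) := by
  unfold condProb
  rw [div_mul_div_comm, div_le_div_iff₀ hB (mul_pos hB hB), ← mul_assoc,
    mul_le_mul_iff_left₀ hB]

/-- Conditional positive correlation given `B` in product form: for `P(B) > 0`,
`P(A | B) P(A' | B) ≤ P(A ∩ A' | B)` iff `P(A ∩ B) P(A' ∩ B) ≤ P(A ∩ A' ∩ B) P(B)`. -/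
lemma mul_condProb_le_condProb_inter_iff {p : E → ℝ} {A A' B : Set (Config E)}
    (hB : 0 < prob p B) :
    condProb p A B * condProb p A' B ≤ condProb p (A ∩ A') B ↔
      prob p (A ∩ B) * prob p (A' ∩ B) ≤ prob p (A ∩ A' ∩ B) * prob p B := by
  unfold condProb
  rw [div_mul_div_comm, div_le_div_iff₀ (mul_pos hB hB) hB, ← mul_assoc,
    mul_le_mul_iff_left₀ hB]

/-! ### Disjoint occurrence, BK, Reimer -/

omit [Fintype E] [DecidableEq E] in
/-- `A` occurs on the edge set `K` in `ω` (cylinder form): every configuration agreeing with `ω`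
on `K` lies in `A`. -/
def OccursOn (A : Set (Config E)) (K : Finset E) (ω : Config E) : Prop :=
  ∀ ω' : Config E, (∀ e ∈ K, ω' e = ω e) → ω' ∈ A

omit [Fintype E] [DecidableEq E] in
/-- Disjoint occurrence `A ◻ B`: `A` and `B` occur on disjoint edge sets (cylinder form; this is
the operation of Reimer's theorem, valid for arbitrary events). -/
def disjOccur (A B : Set (Config E)) : Set (Config E) :=
  {ω | ∃ K L : Finset E, Disjoint K L ∧ OccursOn A K ω ∧ OccursOn B L ω}

@[inherit_doc] scoped infixl:70 " ◻ " => disjOccur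

omit [Fintype E] in
/-- Restriction of a configuration to an edge set: the open edges of `K` stay open, every other
edge is closed. -/
def restrictTo (K : Finset E) (ω : Config E) : Config E := fun e => if e ∈ K then ω e else false

omit [Fintype E] in
/-- Disjoint occurrence in open-witness form: `A` holds already on the open edges of `K`, `B` on
the open edges of `L`, `K` and `L` disjoint. For increasing events this is `A ◻ B`
(`disjOccur_eq_disjOccurRestrict`); it is the form in which the BK inequality is usually proved. -/
def disjOccurRestrict (A B : Set (Config E)) : Set (Config E) :=
  {ω | ∃ K L : Finset E, Disjoint K L ∧ restrictTo K ω ∈ A ∧ restrictTo L ω ∈ B}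

omit [Fintype E] in
/-- A restriction lies below the configuration. -/
lemma restrictTo_le (K : Finset E) (ω : Config E) : restrictTo K ω ≤ ω := by
  intro e
  unfold restrictTo
  split_ifs
  · exact le_rfl
  · exact Bool.false_le _

omit [Fintype E] in
/-- A restriction agrees with the configuration on the kept edges. -/
lemma restrictTo_agree (K : Finset E) (ω : Config E) {e : E} (he : e ∈ K) :
    restrictTo K ω e = ω e := by
  simp [restrictTo, he]

omit [Fintype E] in
/-- For an increasing event, occurring on `K` (cylinder form) is the same as holding on the
restriction to `K`. -/
lemma occursOn_iff_restrictTo_mem {A : Set (Config E)} (hA : IsUpperSet A) (K : Finset E)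
    (ω : Config E) : OccursOn A K ω ↔ restrictTo K ω ∈ A := by
  constructor
  · intro h
    exact h _ fun e he => restrictTo_agree K ω he
  · intro h ω' hω'
    refine hA (fun e => ?_) h
    unfold restrictTo
    split_ifs with he
    · exact (hω' e he).symm.le
    · exact Bool.false_le _

omit [Fintype E] in
/-- For increasing events the two forms of disjoint occurrence coincide. -/
lemma disjOccur_eq_disjOccurRestrict {A B : Set (Config E)} (hA : IsUpperSet A)
    (hB : IsUpperSet B) : A ◻ B = disjOccurRestrict A B := by
  ext ω
  simp only [disjOccur, disjOccurRestrict, Set.mem_setOf_eq, occursOn_iff_restrictTo_mem hA,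
    occursOn_iff_restrictTo_mem hB]

omit [Fintype E] [DecidableEq E] in
/-- `A ◻ B ⊆ A ∩ B`. -/
lemma disjOccur_subset_inter (A B : Set (Config E)) : A ◻ B ⊆ A ∩ B := by
  rintro ω ⟨K, L, -, hK, hL⟩
  exact ⟨hK ω fun _ _ => rfl, hL ω fun _ _ => rfl⟩

/-- **BK inequality** (van den Berg–Kesten 1985), stated as a named Prop for the edge type `E`:
for increasing events, `P(A ◻ B) ≤ P(A) P(B)`. Not in Mathlib; a hypothesis until proved in this
directory (the cell's provers work on the open-witness form `disjOccurRestrict`, which is the same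
set for increasing events by `disjOccur_eq_disjOccurRestrict`). -/
def BKInequality (E : Type*) [Fintype E] [DecidableEq E] : Prop :=
  ∀ (p : E → ℝ), IsProb p → ∀ A B : Set (Config E), IsUpperSet A → IsUpperSet B →
    prob p (A ◻ B) ≤ prob p A * prob p B

/-- **Reimer's inequality** (van den Berg–Kesten–Reimer; Reimer 2000), stated as a named Prop for
the edge type `E`: for arbitrary events, `P(A ◻ B) ≤ P(A) P(B)`. Not in Mathlib; a hypothesis
until proved in this directory. -/
def ReimerInequality (E : Type*) [Fintype E] [DecidableEq E] : Prop :=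
  ∀ (p : E → ℝ), IsProb p → ∀ A B : Set (Config E),
    prob p (A ◻ B) ≤ prob p A * prob p B

/-- Reimer implies BK (BK is the increasing special case). -/
theorem BKInequality_of_ReimerInequality (h : ReimerInequality E) : BKInequality E :=
  fun p hp A B _ _ => h p hp A B

/-- The BK inequality in open-witness form for increasing events is the same statement as
`BKInequality E` (this is the form the cell's provers prove). -/
theorem BKInequality_iff_restrict :
    BKInequality E ↔
      ∀ (p : E → ℝ), IsProb p → ∀ A B : Set (Config E), IsUpperSet A → IsUpperSet B →
        prob p (disjOccurRestrict A B) ≤ prob p A * prob p B := by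
  constructor
  · intro h p hp A B hA hB
    rw [← disjOccur_eq_disjOccurRestrict hA hB]
    exact h p hp A B hA hB
  · intro h p hp A B hA hB
    rw [disjOccur_eq_disjOccurRestrict hA hB]
    exact h p hp A B hA hB

end PercRepro
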